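import Summits.HodgeConjecture.HodgeConjecture.Theorems.PadicSemiregularLiftFermatAnchorAssemblyStubEulerBaseChangeAux
import Summits.HodgeConjecture.HodgeConjecture.Theorems.PadicSemiregularLiftFermatAnchorAssemblyEulerFiniteness
import Summits.HodgeConjecture.HodgeConjecture.Theorems.PadicSemiregularLiftFermatAnchorAssemblyEulerSemicontinuity

/-!
# `stub_eulerBaseChange` (line `witt-lift-rigid-mf` of crux `FermatAnchorAssembly`, stmt-HodgeConjecture-14874)

Route `PadicSemiregularLift` of `HodgeConjecture`. This file CLOSES the registered stub
`stub_eulerBaseChange`: for `p ∤ m`, a perfect field `𝕜` of characteristic `p` with a primitive `m`-th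
root `ζ`, and a lawful `L`-graded matrix factorization `M_W` of `Σ xᵢᵐ` over `𝕎 𝕜`, there is a
characteristic-zero model — `K = Frac 𝕎 𝕜`, `ζ_K = teichmuller ζ`, `N = M_W ⊗ K` — with the same charge
polynomial as `M_W ⊗ 𝕜`.

By the landed reduction `stub_eulerBaseChange_of_eulerForm_baseChange` (`…StubEulerBaseChangeAux`) it
remains to prove the EULER-FORM BASE-CHANGE INVARIANCE `eulerForm_baseChange`: for lawful `M₁, M₂` over
`𝕎 𝕜`, `χ_K(M₁ ⊗ K, M₂ ⊗ K) = χ_𝕜(M₁ ⊗ 𝕜, M₂ ⊗ 𝕜)`. Proof (files `…EulerCochains/Coords/HomDim/Proj/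
Homotopy/Finiteness/BaseChangeRank/Semicontinuity`):
1. `homDim = dim C_t − dRank_t − hRank_t` and `homDim(·, N[1]) = dim C'_{t+m} − hRank_{t+m} − dRank_t`
   for lawful pairs, so the `j`-th summand of `χ` is `dim C_{jm} − dim C'_{(j+1)m} − hRank_{jm} + hRank_{(j+1)m}`
   and the cochain dimensions are the same on both fibres;
2. `m` is a unit in `𝕜` and in `K`, so on both fibres `homDim` (into `N` and into `N[1]`) vanishes for
   `|t| > J` (Hom-finiteness); there `dRank + hRank = dim C_t` on both fibres, and since each rank over
   `𝕜` is at most the rank over `K` (semicontinuity), `hRank^𝕜_t = hRank^K_t` for `|t| > J`;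
3. both `finsum`s are finite sums over `|j| ≤ J + 1`, and their difference telescopes to
   `ε_{(J+2)m} − ε_{−(J+1)m} = 0`, `ε_t = hRank^K_t − hRank^𝕜_t`.
No named fact, no `sorry`.
-/

-- `Summit.HodgeConjecture.HodgeConjecture.…` is the tree's mandated summit/problem namespace (single-problem summit).
set_option linter.dupNamespace false

noncomputable section

open Finset Module

namespace Summit.HodgeConjecture.HodgeConjecture.Cruxes.FermatAnchorAssembly.WittLiftRigidMf

namespace GMFData

variable {p : ℕ} [Fact p.Prime] {𝕜 : Type} [Field 𝕜] [CharP 𝕜 p] [PerfectRing 𝕜 p] {ν m : ℕ}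
  {ι₀ ι₁ κ₀ κ₁ : Type} [Fintype ι₀] [Fintype ι₁] [Fintype κ₀] [Fintype κ₁] [DecidableEq ι₀]
  [DecidableEq ι₁] [DecidableEq κ₀] [DecidableEq κ₁] {L : AddSubgroup (Fin ν → ZMod m)}

/-- Where `homDim` vanishes on BOTH fibres, the odd ranks agree (ranks are semicontinuous and add up to
the common cochain dimension). [folklore] -/
theorem hRank_fibres_eq_of_homDim_eq_zero (M₁ : GMF (WittVector p 𝕜) ν m L ι₀ ι₁)
    (M₂ : GMF (WittVector p 𝕜) ν m L κ₀ κ₁) (t : ℤ)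
    (h𝕜 : homDim 𝕜 L t (M₁.baseChange (WittVector.constantCoeff : WittVector p 𝕜 →+* 𝕜)).toGMFData
      (M₂.baseChange (WittVector.constantCoeff : WittVector p 𝕜 →+* 𝕜)).toGMFData = 0)
    (hK : homDim (FractionRing (WittVector p 𝕜)) L t (M₁.baseChange (algebraMap (WittVector p 𝕜) (FractionRing (WittVector p 𝕜)))).toGMFData
      (M₂.baseChange (algebraMap (WittVector p 𝕜) (FractionRing (WittVector p 𝕜)))).toGMFData = 0) :
    hRank L t (M₁.baseChange (WittVector.constantCoeff : WittVector p 𝕜 →+* 𝕜)).toGMFData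
        (M₂.baseChange (WittVector.constantCoeff : WittVector p 𝕜 →+* 𝕜)).toGMFData =
      hRank L t (M₁.baseChange (algebraMap (WittVector p 𝕜) (FractionRing (WittVector p 𝕜)))).toGMFData
        (M₂.baseChange (algebraMap (WittVector p 𝕜) (FractionRing (WittVector p 𝕜)))).toGMFData := by
  have e𝕜 := homDim_add_ranks (M₁.baseChange (WittVector.constantCoeff : WittVector p 𝕜 →+* 𝕜))
    (M₂.baseChange (WittVector.constantCoeff : WittVector p 𝕜 →+* 𝕜)) t
  have eK := homDim_add_ranks (M₁.baseChange (algebraMap (WittVector p 𝕜) (FractionRing (WittVector p 𝕜))))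
    (M₂.baseChange (algebraMap (WittVector p 𝕜) (FractionRing (WittVector p 𝕜)))) t
  have hv : finrank (FractionRing (WittVector p 𝕜)) (cochainSub L t (M₁.baseChange (algebraMap (WittVector p 𝕜) (FractionRing (WittVector p 𝕜)))).toGMFData
      (M₂.baseChange (algebraMap (WittVector p 𝕜) (FractionRing (WittVector p 𝕜)))).toGMFData) =
      finrank 𝕜 (cochainSub L t (M₁.baseChange (WittVector.constantCoeff : WittVector p 𝕜 →+* 𝕜)).toGMFData
        (M₂.baseChange (WittVector.constantCoeff : WittVector p 𝕜 →+* 𝕜)).toGMFData) :=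
    finrank_cochainSub_baseChange (WittVector p 𝕜) (FractionRing (WittVector p 𝕜)) 𝕜 (algebraMap (WittVector p 𝕜) (FractionRing (WittVector p 𝕜)))
      (WittVector.constantCoeff : WittVector p 𝕜 →+* 𝕜) ν m L ι₀ ι₁ κ₀ κ₁ t M₁.toGMFData M₂.toGMFData
  have hd : dRank L t (M₁.baseChange (WittVector.constantCoeff : WittVector p 𝕜 →+* 𝕜)).toGMFData
      (M₂.baseChange (WittVector.constantCoeff : WittVector p 𝕜 →+* 𝕜)).toGMFData ≤
      dRank L t (M₁.baseChange (algebraMap (WittVector p 𝕜) (FractionRing (WittVector p 𝕜)))).toGMFData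
        (M₂.baseChange (algebraMap (WittVector p 𝕜) (FractionRing (WittVector p 𝕜)))).toGMFData :=
    dRank_residue_le p L t M₁.toGMFData M₂.toGMFData
  have hh : hRank L t (M₁.baseChange (WittVector.constantCoeff : WittVector p 𝕜 →+* 𝕜)).toGMFData
      (M₂.baseChange (WittVector.constantCoeff : WittVector p 𝕜 →+* 𝕜)).toGMFData ≤
      hRank L t (M₁.baseChange (algebraMap (WittVector p 𝕜) (FractionRing (WittVector p 𝕜)))).toGMFData
        (M₂.baseChange (algebraMap (WittVector p 𝕜) (FractionRing (WittVector p 𝕜)))).toGMFData :=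
    hRank_residue_le p L t M₁.toGMFData M₂.toGMFData
  omega

omit [PerfectRing 𝕜 p] in
/-- The difference of the `j`-th summands of the two Euler forms is a difference of consecutive
rank defects `ε_t = hRank^K_t − hRank^𝕜_t`. [folklore] -/
theorem eulerSummand_fibres_sub (M₁ : GMF (WittVector p 𝕜) ν m L ι₀ ι₁)
    (M₂ : GMF (WittVector p 𝕜) ν m L κ₀ κ₁) (j : ℤ) :
    ((homDim (FractionRing (WittVector p 𝕜)) L (j * m) (M₁.baseChange (algebraMap (WittVector p 𝕜) (FractionRing (WittVector p 𝕜)))).toGMFData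
          (M₂.baseChange (algebraMap (WittVector p 𝕜) (FractionRing (WittVector p 𝕜)))).toGMFData : ℤ) -
        (homDim (FractionRing (WittVector p 𝕜)) L (j * m) (M₁.baseChange (algebraMap (WittVector p 𝕜) (FractionRing (WittVector p 𝕜)))).toGMFData
          (M₂.baseChange (algebraMap (WittVector p 𝕜) (FractionRing (WittVector p 𝕜)))).toGMFData.shift : ℤ)) -
      ((homDim 𝕜 L (j * m) (M₁.baseChange (WittVector.constantCoeff : WittVector p 𝕜 →+* 𝕜)).toGMFData
          (M₂.baseChange (WittVector.constantCoeff : WittVector p 𝕜 →+* 𝕜)).toGMFData : ℤ) -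
        (homDim 𝕜 L (j * m) (M₁.baseChange (WittVector.constantCoeff : WittVector p 𝕜 →+* 𝕜)).toGMFData
          (M₂.baseChange (WittVector.constantCoeff : WittVector p 𝕜 →+* 𝕜)).toGMFData.shift : ℤ)) =
    ((hRank L (j * m + m) (M₁.baseChange (algebraMap (WittVector p 𝕜) (FractionRing (WittVector p 𝕜)))).toGMFData
          (M₂.baseChange (algebraMap (WittVector p 𝕜) (FractionRing (WittVector p 𝕜)))).toGMFData : ℤ) -
        (hRank L (j * m + m) (M₁.baseChange (WittVector.constantCoeff : WittVector p 𝕜 →+* 𝕜)).toGMFData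
          (M₂.baseChange (WittVector.constantCoeff : WittVector p 𝕜 →+* 𝕜)).toGMFData : ℤ)) -
      ((hRank L (j * m) (M₁.baseChange (algebraMap (WittVector p 𝕜) (FractionRing (WittVector p 𝕜)))).toGMFData
          (M₂.baseChange (algebraMap (WittVector p 𝕜) (FractionRing (WittVector p 𝕜)))).toGMFData : ℤ) -
        (hRank L (j * m) (M₁.baseChange (WittVector.constantCoeff : WittVector p 𝕜 →+* 𝕜)).toGMFData
          (M₂.baseChange (WittVector.constantCoeff : WittVector p 𝕜 →+* 𝕜)).toGMFData : ℤ)) := by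
  have eK := eulerSummand_eq (M₁.baseChange (algebraMap (WittVector p 𝕜) (FractionRing (WittVector p 𝕜))))
    (M₂.baseChange (algebraMap (WittVector p 𝕜) (FractionRing (WittVector p 𝕜)))) j
  have e𝕜 := eulerSummand_eq (M₁.baseChange (WittVector.constantCoeff : WittVector p 𝕜 →+* 𝕜))
    (M₂.baseChange (WittVector.constantCoeff : WittVector p 𝕜 →+* 𝕜)) j
  have hv : finrank (FractionRing (WittVector p 𝕜)) (cochainSub L (j * m) (M₁.baseChange (algebraMap (WittVector p 𝕜) (FractionRing (WittVector p 𝕜)))).toGMFData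
      (M₂.baseChange (algebraMap (WittVector p 𝕜) (FractionRing (WittVector p 𝕜)))).toGMFData) =
      finrank 𝕜 (cochainSub L (j * m) (M₁.baseChange (WittVector.constantCoeff : WittVector p 𝕜 →+* 𝕜)).toGMFData
        (M₂.baseChange (WittVector.constantCoeff : WittVector p 𝕜 →+* 𝕜)).toGMFData) :=
    finrank_cochainSub_baseChange (WittVector p 𝕜) (FractionRing (WittVector p 𝕜)) 𝕜 (algebraMap (WittVector p 𝕜) (FractionRing (WittVector p 𝕜)))
      (WittVector.constantCoeff : WittVector p 𝕜 →+* 𝕜) ν m L ι₀ ι₁ κ₀ κ₁ (j * m) M₁.toGMFData M₂.toGMFData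
  have hw : finrank (FractionRing (WittVector p 𝕜)) (oddSub L (j * m + m) (M₁.baseChange (algebraMap (WittVector p 𝕜) (FractionRing (WittVector p 𝕜)))).toGMFData
      (M₂.baseChange (algebraMap (WittVector p 𝕜) (FractionRing (WittVector p 𝕜)))).toGMFData) =
      finrank 𝕜 (oddSub L (j * m + m) (M₁.baseChange (WittVector.constantCoeff : WittVector p 𝕜 →+* 𝕜)).toGMFData
        (M₂.baseChange (WittVector.constantCoeff : WittVector p 𝕜 →+* 𝕜)).toGMFData) :=
    finrank_oddSub_baseChange (WittVector p 𝕜) (FractionRing (WittVector p 𝕜)) 𝕜 (algebraMap (WittVector p 𝕜) (FractionRing (WittVector p 𝕜)))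
      (WittVector.constantCoeff : WittVector p 𝕜 →+* 𝕜) ν m L ι₀ ι₁ κ₀ κ₁ (j * m + m) M₁.toGMFData M₂.toGMFData
  rw [eK, e𝕜, hv, hw]
  ring

/-- **The Euler form is the same on the two fibres** (base-change form of `eulerForm_baseChange`). [folklore] -/
theorem eulerForm_fibres_eq (hpm : ¬ p ∣ m) (M₁ : GMF (WittVector p 𝕜) ν m L ι₀ ι₁)
    (M₂ : GMF (WittVector p 𝕜) ν m L κ₀ κ₁) :
    eulerForm (FractionRing (WittVector p 𝕜)) L (M₁.baseChange (algebraMap (WittVector p 𝕜) (FractionRing (WittVector p 𝕜)))).toGMFData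
        (M₂.baseChange (algebraMap (WittVector p 𝕜) (FractionRing (WittVector p 𝕜)))).toGMFData =
      eulerForm 𝕜 L (M₁.baseChange (WittVector.constantCoeff : WittVector p 𝕜 →+* 𝕜)).toGMFData
        (M₂.baseChange (WittVector.constantCoeff : WittVector p 𝕜 →+* 𝕜)).toGMFData := by
  -- `m` is a unit on both fibres
  have hm0 : m ≠ 0 := by rintro rfl; exact hpm (dvd_zero p)
  have hm𝕜 : IsUnit (m : 𝕜) := by
    rw [isUnit_iff_ne_zero, Ne, CharP.cast_eq_zero_iff 𝕜 p]
    exact hpm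
  haveI : CharZero (FractionRing (WittVector p 𝕜)) := charZero_fractionRing_wittVector p 𝕜
  have hmK : IsUnit (m : (FractionRing (WittVector p 𝕜))) := by
    rw [isUnit_iff_ne_zero]
    exact Nat.cast_ne_zero.mpr hm0
  -- Hom-finiteness on both fibres, into `M₂` and into `M₂[1]`
  have f1 := finite_setOf_homDim_ne_zero 𝕜 ν m L ι₀ ι₁ κ₀ κ₁ (M₁.baseChange (WittVector.constantCoeff : WittVector p 𝕜 →+* 𝕜))
    (M₂.baseChange (WittVector.constantCoeff : WittVector p 𝕜 →+* 𝕜)) hm𝕜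
  have f2 := finite_setOf_homDim_ne_zero 𝕜 ν m L ι₀ ι₁ κ₁ κ₀ (M₁.baseChange (WittVector.constantCoeff : WittVector p 𝕜 →+* 𝕜))
    (M₂.baseChange (WittVector.constantCoeff : WittVector p 𝕜 →+* 𝕜)).shift hm𝕜
  have f3 := finite_setOf_homDim_ne_zero (FractionRing (WittVector p 𝕜)) ν m L ι₀ ι₁ κ₀ κ₁
    (M₁.baseChange (algebraMap (WittVector p 𝕜) (FractionRing (WittVector p 𝕜))))
    (M₂.baseChange (algebraMap (WittVector p 𝕜) (FractionRing (WittVector p 𝕜)))) hmK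
  have f4 := finite_setOf_homDim_ne_zero (FractionRing (WittVector p 𝕜)) ν m L ι₀ ι₁ κ₁ κ₀
    (M₁.baseChange (algebraMap (WittVector p 𝕜) (FractionRing (WittVector p 𝕜))))
    (M₂.baseChange (algebraMap (WittVector p 𝕜) (FractionRing (WittVector p 𝕜)))).shift hmK
  -- a common bound `J`
  have hfin := ((f1.union f2).union f3).union f4
  obtain ⟨J, hJ⟩ : ∃ J : ℕ, ∀ t : ℤ, J < t.natAbs →
      homDim 𝕜 L t (M₁.baseChange (WittVector.constantCoeff : WittVector p 𝕜 →+* 𝕜)).toGMFData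
        (M₂.baseChange (WittVector.constantCoeff : WittVector p 𝕜 →+* 𝕜)).toGMFData = 0 ∧
      homDim 𝕜 L t (M₁.baseChange (WittVector.constantCoeff : WittVector p 𝕜 →+* 𝕜)).toGMFData
        (M₂.baseChange (WittVector.constantCoeff : WittVector p 𝕜 →+* 𝕜)).toGMFData.shift = 0 ∧
      homDim (FractionRing (WittVector p 𝕜)) L t (M₁.baseChange (algebraMap (WittVector p 𝕜) (FractionRing (WittVector p 𝕜)))).toGMFData
        (M₂.baseChange (algebraMap (WittVector p 𝕜) (FractionRing (WittVector p 𝕜)))).toGMFData = 0 ∧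
      homDim (FractionRing (WittVector p 𝕜)) L t (M₁.baseChange (algebraMap (WittVector p 𝕜) (FractionRing (WittVector p 𝕜)))).toGMFData
        (M₂.baseChange (algebraMap (WittVector p 𝕜) (FractionRing (WittVector p 𝕜)))).toGMFData.shift = 0 := by
    refine ⟨hfin.toFinset.sup Int.natAbs, fun t ht ↦ ?_⟩
    have hnot : t ∉ hfin.toFinset := by
      intro hmem
      have := Finset.le_sup (f := Int.natAbs) hmem
      omega
    rw [Set.Finite.mem_toFinset] at hnot
    simp only [Set.mem_union, Set.mem_setOf_eq, not_or, not_not] at hnot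
    exact ⟨hnot.1.1.1, hnot.1.1.2, hnot.1.2, hnot.2⟩
  have hvan : ∀ j : ℤ, J < j.natAbs →
      homDim 𝕜 L (j * m) (M₁.baseChange (WittVector.constantCoeff : WittVector p 𝕜 →+* 𝕜)).toGMFData
        (M₂.baseChange (WittVector.constantCoeff : WittVector p 𝕜 →+* 𝕜)).toGMFData = 0 ∧
      homDim 𝕜 L (j * m) (M₁.baseChange (WittVector.constantCoeff : WittVector p 𝕜 →+* 𝕜)).toGMFData
        (M₂.baseChange (WittVector.constantCoeff : WittVector p 𝕜 →+* 𝕜)).toGMFData.shift = 0 ∧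
      homDim (FractionRing (WittVector p 𝕜)) L (j * m) (M₁.baseChange (algebraMap (WittVector p 𝕜) (FractionRing (WittVector p 𝕜)))).toGMFData
        (M₂.baseChange (algebraMap (WittVector p 𝕜) (FractionRing (WittVector p 𝕜)))).toGMFData = 0 ∧
      homDim (FractionRing (WittVector p 𝕜)) L (j * m) (M₁.baseChange (algebraMap (WittVector p 𝕜) (FractionRing (WittVector p 𝕜)))).toGMFData
        (M₂.baseChange (algebraMap (WittVector p 𝕜) (FractionRing (WittVector p 𝕜)))).toGMFData.shift = 0 := by
    intro j hj
    apply hJ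
    rw [Int.natAbs_mul, Int.natAbs_natCast]
    exact lt_of_lt_of_le hj (Nat.le_mul_of_pos_right _ (Nat.pos_of_ne_zero hm0))
  -- the rank defect `ε t = hRank^K_t − hRank^𝕜_t` vanishes beyond `J`
  have hεvan : ∀ j : ℤ, J < j.natAbs →
      (hRank L (j * m) (M₁.baseChange (algebraMap (WittVector p 𝕜) (FractionRing (WittVector p 𝕜)))).toGMFData
          (M₂.baseChange (algebraMap (WittVector p 𝕜) (FractionRing (WittVector p 𝕜)))).toGMFData : ℤ) -
        (hRank L (j * m) (M₁.baseChange (WittVector.constantCoeff : WittVector p 𝕜 →+* 𝕜)).toGMFData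
          (M₂.baseChange (WittVector.constantCoeff : WittVector p 𝕜 →+* 𝕜)).toGMFData : ℤ) = 0 := by
    intro j hj
    obtain ⟨h1, -, h3, -⟩ := hvan j hj
    rw [hRank_fibres_eq_of_homDim_eq_zero M₁ M₂ (j * m) h1 h3, sub_self]
  -- both `finsum`s are finite sums over the same window
  have hwin : ∀ j : ℤ, j.natAbs ≤ J →
      j ∈ (Finset.range (2 * J + 3)).image (fun k : ℕ ↦ (k : ℤ) - (J + 1)) := by
    intro j hj
    rw [Finset.mem_image]
    exact ⟨(j + (J + 1)).toNat, Finset.mem_range.mpr (by omega), by omega⟩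
  have hsuppK : Function.support (fun j : ℤ ↦
      (homDim (FractionRing (WittVector p 𝕜)) L (j * m) (M₁.baseChange (algebraMap (WittVector p 𝕜) (FractionRing (WittVector p 𝕜)))).toGMFData
          (M₂.baseChange (algebraMap (WittVector p 𝕜) (FractionRing (WittVector p 𝕜)))).toGMFData : ℤ) -
        (homDim (FractionRing (WittVector p 𝕜)) L (j * m) (M₁.baseChange (algebraMap (WittVector p 𝕜) (FractionRing (WittVector p 𝕜)))).toGMFData
          (M₂.baseChange (algebraMap (WittVector p 𝕜) (FractionRing (WittVector p 𝕜)))).toGMFData.shift : ℤ)) ⊆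
      ↑((Finset.range (2 * J + 3)).image (fun k : ℕ ↦ (k : ℤ) - (J + 1))) := by
    intro j hj
    rw [Function.mem_support] at hj
    refine hwin j (not_lt.mp fun h ↦ hj ?_)
    obtain ⟨-, -, h3, h4⟩ := hvan j h
    rw [h3, h4, sub_self]
  have hsupp𝕜 : Function.support (fun j : ℤ ↦
      (homDim 𝕜 L (j * m) (M₁.baseChange (WittVector.constantCoeff : WittVector p 𝕜 →+* 𝕜)).toGMFData
          (M₂.baseChange (WittVector.constantCoeff : WittVector p 𝕜 →+* 𝕜)).toGMFData : ℤ) -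
        (homDim 𝕜 L (j * m) (M₁.baseChange (WittVector.constantCoeff : WittVector p 𝕜 →+* 𝕜)).toGMFData
          (M₂.baseChange (WittVector.constantCoeff : WittVector p 𝕜 →+* 𝕜)).toGMFData.shift : ℤ)) ⊆
      ↑((Finset.range (2 * J + 3)).image (fun k : ℕ ↦ (k : ℤ) - (J + 1))) := by
    intro j hj
    rw [Function.mem_support] at hj
    refine hwin j (not_lt.mp fun h ↦ hj ?_)
    obtain ⟨h1, h2, -, -⟩ := hvan j h
    rw [h1, h2, sub_self]
  unfold eulerForm
  rw [finsum_eq_sum_of_support_subset _ hsuppK, finsum_eq_sum_of_support_subset _ hsupp𝕜, ← sub_eq_zero,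
    ← Finset.sum_sub_distrib]
  -- the difference telescopes
  have hinj : ∀ k ∈ Finset.range (2 * J + 3), ∀ k' ∈ Finset.range (2 * J + 3),
      (fun k : ℕ ↦ (k : ℤ) - (J + 1)) k = (fun k : ℕ ↦ (k : ℤ) - (J + 1)) k' → k = k' := by
    intro k _ k' _ h
    have h' : (k : ℤ) - (J + 1) = (k' : ℤ) - (J + 1) := h
    omega
  rw [Finset.sum_image hinj]
  have hterm : ∀ k : ℕ,
      ((homDim (FractionRing (WittVector p 𝕜)) L (((k : ℤ) - (J + 1)) * m) (M₁.baseChange (algebraMap (WittVector p 𝕜) (FractionRing (WittVector p 𝕜)))).toGMFData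
            (M₂.baseChange (algebraMap (WittVector p 𝕜) (FractionRing (WittVector p 𝕜)))).toGMFData : ℤ) -
          (homDim (FractionRing (WittVector p 𝕜)) L (((k : ℤ) - (J + 1)) * m) (M₁.baseChange (algebraMap (WittVector p 𝕜) (FractionRing (WittVector p 𝕜)))).toGMFData
            (M₂.baseChange (algebraMap (WittVector p 𝕜) (FractionRing (WittVector p 𝕜)))).toGMFData.shift : ℤ)) -
        ((homDim 𝕜 L (((k : ℤ) - (J + 1)) * m) (M₁.baseChange (WittVector.constantCoeff : WittVector p 𝕜 →+* 𝕜)).toGMFData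
            (M₂.baseChange (WittVector.constantCoeff : WittVector p 𝕜 →+* 𝕜)).toGMFData : ℤ) -
          (homDim 𝕜 L (((k : ℤ) - (J + 1)) * m) (M₁.baseChange (WittVector.constantCoeff : WittVector p 𝕜 →+* 𝕜)).toGMFData
            (M₂.baseChange (WittVector.constantCoeff : WittVector p 𝕜 →+* 𝕜)).toGMFData.shift : ℤ)) =
      ((hRank L ((((k + 1 : ℕ) : ℤ) - (J + 1)) * m) (M₁.baseChange (algebraMap (WittVector p 𝕜) (FractionRing (WittVector p 𝕜)))).toGMFData
            (M₂.baseChange (algebraMap (WittVector p 𝕜) (FractionRing (WittVector p 𝕜)))).toGMFData : ℤ) -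
          (hRank L ((((k + 1 : ℕ) : ℤ) - (J + 1)) * m) (M₁.baseChange (WittVector.constantCoeff : WittVector p 𝕜 →+* 𝕜)).toGMFData
            (M₂.baseChange (WittVector.constantCoeff : WittVector p 𝕜 →+* 𝕜)).toGMFData : ℤ)) -
        ((hRank L (((k : ℤ) - (J + 1)) * m) (M₁.baseChange (algebraMap (WittVector p 𝕜) (FractionRing (WittVector p 𝕜)))).toGMFData
            (M₂.baseChange (algebraMap (WittVector p 𝕜) (FractionRing (WittVector p 𝕜)))).toGMFData : ℤ) -
          (hRank L (((k : ℤ) - (J + 1)) * m) (M₁.baseChange (WittVector.constantCoeff : WittVector p 𝕜 →+* 𝕜)).toGMFData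
            (M₂.baseChange (WittVector.constantCoeff : WittVector p 𝕜 →+* 𝕜)).toGMFData : ℤ)) := by
    intro k
    rw [eulerSummand_fibres_sub M₁ M₂ ((k : ℤ) - (J + 1))]
    have : (((k + 1 : ℕ) : ℤ) - (J + 1)) * m = ((k : ℤ) - (J + 1)) * m + m := by push_cast; ring
    rw [this]
  rw [Finset.sum_congr rfl fun k _ ↦ hterm k,
    Finset.sum_range_sub (fun k : ℕ ↦
      (hRank L (((k : ℤ) - (J + 1)) * m) (M₁.baseChange (algebraMap (WittVector p 𝕜) (FractionRing (WittVector p 𝕜)))).toGMFData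
          (M₂.baseChange (algebraMap (WittVector p 𝕜) (FractionRing (WittVector p 𝕜)))).toGMFData : ℤ) -
        (hRank L (((k : ℤ) - (J + 1)) * m) (M₁.baseChange (WittVector.constantCoeff : WittVector p 𝕜 →+* 𝕜)).toGMFData
          (M₂.baseChange (WittVector.constantCoeff : WittVector p 𝕜 →+* 𝕜)).toGMFData : ℤ))]
  have hlast : (((2 * J + 3 : ℕ) : ℤ) - (J + 1)) = ((J + 2 : ℕ) : ℤ) := by push_cast; ring
  have hfirst : (((0 : ℕ) : ℤ) - (J + 1)) = -((J + 1 : ℕ) : ℤ) := by push_cast; ring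
  rw [hlast, hfirst, hεvan _ (by rw [Int.natAbs_natCast]; omega), hεvan _ (by
    rw [Int.natAbs_neg, Int.natAbs_natCast]; omega), sub_zero]

end GMFData

/-! ### H4 — the Euler-form base-change invariance, and the registered stub -/

/-- **H4: the Euler form of a pair of lawful `𝕎 𝕜`-factorizations is the same on the two fibres**,
`χ_{Frac 𝕎}(M₁ ⊗ K, M₂ ⊗ K) = χ_𝕜(M₁ ⊗ 𝕜, M₂ ⊗ 𝕜)` for `p ∤ m` (Hom-finiteness on both fibres, rank
semicontinuity, telescoping; see the module docstring). This is exactly the hypothesis of the landed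
reduction `stub_eulerBaseChange_of_eulerForm_baseChange`. [cite: BallardFaveroKatzarkov2011, §2 (graded matrix factorizations)] -/
theorem eulerForm_baseChange :
    ∀ (p : ℕ) [Fact p.Prime] (𝕜 : Type) [Field 𝕜] [CharP 𝕜 p] [PerfectRing 𝕜 p] (ν m : ℕ), ¬ p ∣ m →
      ∀ (ι₀ ι₁ κ₀ κ₁ : Type) [Fintype ι₀] [Fintype ι₁] [Fintype κ₀] [Fintype κ₁]
        [DecidableEq ι₀] [DecidableEq ι₁] [DecidableEq κ₀] [DecidableEq κ₁]
        (L : AddSubgroup (Fin ν → ZMod m)) (M₁ : GMF (WittVector p 𝕜) ν m L ι₀ ι₁)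
        (M₂ : GMF (WittVector p 𝕜) ν m L κ₀ κ₁),
        GMFData.eulerForm (FractionRing (WittVector p 𝕜)) L
            (M₁.toGMFData.map (algebraMap (WittVector p 𝕜) (FractionRing (WittVector p 𝕜))))
            (M₂.toGMFData.map (algebraMap (WittVector p 𝕜) (FractionRing (WittVector p 𝕜)))) =
          GMFData.eulerForm 𝕜 L (M₁.toGMFData.map (WittVector.constantCoeff : WittVector p 𝕜 →+* 𝕜))
            (M₂.toGMFData.map (WittVector.constantCoeff : WittVector p 𝕜 →+* 𝕜)) :=
  fun _ _ _ _ _ _ _ _ hpm _ _ _ _ _ _ _ _ _ _ _ _ _ M₁ M₂ ↦ GMFData.eulerForm_fibres_eq hpm M₁ M₂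

/-- **L2 `stub_eulerBaseChange` — THE CHARGE POLYNOMIAL OF A `𝕎`-FACTORIZATION IS THE SAME ON BOTH
FIBRES.** For `p ∤ m`, a primitive `m`-th root `ζ ∈ 𝕜` (`𝕜` perfect of characteristic `p`) and a lawful
`L`-graded factorization `M_W` of `Σxᵢᵐ` over `𝕎 𝕜`, there is a field `K ⊇ ℚ` with a primitive `m`-th
root `ζ_K` and a lawful factorization `N` over `K` with `Θ_{γ,N} = Θ_{γ, M_W ⊗ 𝕜}`: `K = Frac 𝕎 𝕜`,
`ζ_K = teichmuller ζ`, `N = M_W ⊗ K` (`stub_eulerBaseChange_of_eulerForm_baseChange`), the coefficients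
agreeing by the Euler-form base-change invariance `eulerForm_baseChange`. [cite: BallardFaveroKatzarkov2011, §2 (graded matrix factorizations)] -/
theorem stub_eulerBaseChange :
    ∀ (p : ℕ) [Fact p.Prime] (𝕜 : Type) [Field 𝕜] [CharP 𝕜 p] [PerfectRing 𝕜 p] (ν m : ℕ) [NeZero m],
    ¬ p ∣ m → ∀ (ζ : 𝕜), IsPrimitiveRoot ζ m → ∀ (γ : Fin ν → ZMod m)
    (ι₀ ι₁ : Type) [Fintype ι₀] [Fintype ι₁] [DecidableEq ι₀] [DecidableEq ι₁]
    (L : AddSubgroup (Fin ν → ZMod m)) (MW : GMF (WittVector p 𝕜) ν m L ι₀ ι₁),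
    Nonempty (CharZeroModel L ι₀ ι₁ γ
      (GMFData.thetaPoly 𝕜 L ζ γ (MW.toGMFData.map (WittVector.constantCoeff : WittVector p 𝕜 →+* 𝕜)))) :=
  stub_eulerBaseChange_of_eulerForm_baseChange eulerForm_baseChange

end Summit.HodgeConjecture.HodgeConjecture.Cruxes.FermatAnchorAssembly.WittLiftRigidMf

end
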